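import Summits.NavierStokesRegularity.NavierStokesRegularity.Theorems.CoriolisHeadNoCoRotatingCoreOfPineauVicol
import Summits.NavierStokesRegularity.NavierStokesRegularity.Theorems.CoriolisHeadNoCoRotatingCoreSmallAmplitude
import HarnessLib

/-!
# CoriolisHeadNoCoRotatingCoreIffPineauVicol — crux `NoCoRotatingCore` (stmt-NavierStokesRegularity-22676):
# **the crux is EQUIVALENT to Pineau–Vicol's Conjecture 1.1 as printed** (kernel-checked)

With every analytic stub of both lines on the crux landed (registered `far_field_constancy`: K1a p650190, K1b p613432, K1c
p627657; rescue `local_energy_rescue`: S1 p639741, S2 p633214, S3a p645061, S3b p629470) and the composition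
`noCoRotatingCore_of_pineauVicolConjecture` (p645767), the item's declared residual R1 is not only sufficient but also
necessary:

* `pineauVicolConjecture_of_noCoRotatingCore` — `NoCoRotatingCore` ⟹ Conjecture 1.1 as printed (a decaying profile in the printed
  frame `(ν, a, B) = (1, ½, αJ)` is bounded, hence constant by the landed `noCoRotatingCore_iff_rotatedProfileLiouville`, and a
  constant with `‖b‖ ≤ K/(1 + ‖y‖)` for all `y` is `0`);
* `noCoRotatingCore_iff_pineauVicolConjecture` — **`CoriolisHead.NoCoRotatingCore ↔` (Pineau–Vicol Conj. 1.1, profile form, as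
  printed; = the registered residual stub `stub_pineauVicolConjecture`)**.

HONEST FRAMING.  An EQUIVALENCE with an OPEN conjecture: it proves neither side.  It records, kernel-checked, that crux 22676 is
EXACTLY as hard as Conjecture 1.1 (decided in print only at extreme `|α|`, PineauVicol2026 Thm 1.4).  `NoCoRotatingCore` and NS
regularity are NOT proved.

References: B. Pineau, V. Vicol, arXiv:2607.09619, Conj. 1.1, Thm 1.4 [PineauVicol2026]; line cards
`Cruxes/NoCoRotatingCore/Lines/{far_field_constancy,local_energy_rescue}.md`.
-/

noncomputable section

open MeasureTheory Set Function Filter Topology Metric InnerProductSpace Real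
open scoped RealInnerProductSpace Laplacian ContDiff Topology

-- the summit and its single sub-problem share the name (CONVENTIONS §1), as in every Theorems file
set_option linter.dupNamespace false

namespace Summit.NavierStokesRegularity.NavierStokesRegularity.Theorems.CoriolisHead

open Literature.Analysis.FluidPDE Summit.NavierStokesRegularity.NavierStokesRegularity.Theses

/-- **`NoCoRotatingCore` implies Pineau–Vicol's Conjecture 1.1 (profile form, as printed).**  A profile with the Type-I decay
`‖U(y)‖ ≤ K/(1 + ‖y‖)` is bounded by `K`; in the frame `(1, ½, αJ)` (skew: `⟪αJx, x⟫ = 0`) the landed equivalence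
`noCoRotatingCore_iff_rotatedProfileLiouville` makes it a constant `b`, and `‖b‖ ≤ K/(1 + n)` for every `n` forces `b = 0`.
[cite: PineauVicol2026, Conj. 1.1 (arXiv:2607.09619 p. 3)] -/
theorem pineauVicolConjecture_of_noCoRotatingCore (h : CoriolisHead.NoCoRotatingCore) :
    ∀ α : ℝ, α ≠ 0 →
      ∀ (U : EuclideanSpace ℝ (Fin 3) → EuclideanSpace ℝ (Fin 3)) (P : EuclideanSpace ℝ (Fin 3) → ℝ),
      ContDiff ℝ (⊤ : ℕ∞) U → ContDiff ℝ 2 P →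
      Literature.Analysis.FluidPDE.VectorCalculus.IsDivFree U →
      (∀ y, α • (rotGen (U y) - fderiv ℝ U y (rotGen y)) + (1 / 2 : ℝ) • U y
        + (1 / 2 : ℝ) • fderiv ℝ U y y - Laplacian.laplacian U y
        + Literature.Analysis.FluidPDE.convect U U y + gradient P y = 0) →
      (∃ K : ℝ, ∀ y, ‖U y‖ ≤ K / (1 + ‖y‖)) →
      ∀ y, U y = 0 := by
  intro α _ U P hU hP hdiv heq hdec
  obtain ⟨K, hK⟩ := hdec
  have hK0 : 0 ≤ K := by
    have h0 := hK 0
    rw [norm_zero, add_zero, div_one] at h0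
    exact (norm_nonneg _).trans h0
  -- boundedness
  have hbdd : ∃ M : ℝ, ∀ y, ‖U y‖ ≤ M := by
    refine ⟨K, fun y => (hK y).trans ?_⟩
    exact div_le_self hK0 (by linarith [norm_nonneg y])
  -- the crux's system with `ν = 1`, `a = ½`, `B = αJ`
  have hB : ∀ x, inner ℝ ((α • rotGenL) x) x = 0 := fun x => by
    rw [smul_apply, real_inner_smul_left, inner_rotGenL_self, mul_zero]
  have heq' : ∀ y, -((1 : ℝ) • Laplacian.laplacian U y) + (1 / 2 : ℝ) • U y
      + (1 / 2 : ℝ) • fderiv ℝ U y y + ((α • rotGenL) (U y) - fderiv ℝ U y ((α • rotGenL) y))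
      + Literature.Analysis.FluidPDE.convect U U y + gradient P y = 0 := by
    intro y
    have key := heq y
    simp only [smul_apply, rotGenL_apply, ContinuousLinearMap.map_smul, one_smul]
    rw [← key, smul_sub]
    abel
  obtain ⟨b, hb⟩ := (noCoRotatingCore_iff_rotatedProfileLiouville.mp h) 1 (1 / 2) one_pos (by norm_num) (α • rotGenL) U P
    hU hP hB hdiv heq' hbdd
  -- a decaying constant vanishes
  have hb0 : b = 0 := by
    by_contra hne
    have hbpos : 0 < ‖b‖ := norm_pos_iff.2 hne
    obtain ⟨n, hn⟩ := exists_nat_gt (K / ‖b‖)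
    have h3 : K < ‖b‖ * n := by rwa [div_lt_iff₀ hbpos, mul_comm] at hn
    -- test the decay at the point `(n/‖b‖) • b` of norm `n`
    set y' : EuclideanSpace ℝ (Fin 3) := ((n : ℝ) / ‖b‖) • b with hy'
    have hyn' : ‖y'‖ = n := by
      rw [hy', norm_smul, Real.norm_of_nonneg (by positivity), div_mul_cancel₀ _ hbpos.ne']
    have h1' := hK y'
    rw [hb y', hyn'] at h1'
    have h2' : ‖b‖ * (1 + n) ≤ K := by
      have hpos : (0 : ℝ) < 1 + n := by positivity
      rwa [le_div_iff₀ hpos] at h1'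
    nlinarith
  intro y
  rw [hb y, hb0]

/-- **Crux 22676 is equivalent to Pineau–Vicol's Conjecture 1.1 as printed** (profile form, printed frame `(1, ½, αJ)`, `α ≠ 0`,
with Type-I decay; the right-hand side is verbatim the registered residual stub `stub_pineauVicolConjecture` of both lines):
`⟸` is the landed composition `noCoRotatingCore_of_pineauVicolConjecture` (S1, S2, S3a, S3b of the rescue line + the frame
reduction), `⟹` is `pineauVicolConjecture_of_noCoRotatingCore`.  Proves neither side. [cite: PineauVicol2026, Conj. 1.1 and Thm 1.4 (arXiv:2607.09619 pp. 3–4)] -/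
theorem noCoRotatingCore_iff_pineauVicolConjecture :
    CoriolisHead.NoCoRotatingCore ↔
      (∀ α : ℝ, α ≠ 0 →
        ∀ (U : EuclideanSpace ℝ (Fin 3) → EuclideanSpace ℝ (Fin 3)) (P : EuclideanSpace ℝ (Fin 3) → ℝ),
        ContDiff ℝ (⊤ : ℕ∞) U → ContDiff ℝ 2 P →
        Literature.Analysis.FluidPDE.VectorCalculus.IsDivFree U →
        (∀ y, α • (rotGen (U y) - fderiv ℝ U y (rotGen y)) + (1 / 2 : ℝ) • U y
          + (1 / 2 : ℝ) • fderiv ℝ U y y - Laplacian.laplacian U y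
          + Literature.Analysis.FluidPDE.convect U U y + gradient P y = 0) →
        (∃ K : ℝ, ∀ y, ‖U y‖ ≤ K / (1 + ‖y‖)) →
        ∀ y, U y = 0) :=
  ⟨pineauVicolConjecture_of_noCoRotatingCore, noCoRotatingCore_of_pineauVicolConjecture⟩

end Summit.NavierStokesRegularity.NavierStokesRegularity.Theorems.CoriolisHead

end
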